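import Literature.NumberTheory.EllipticCurves.HeegnerCharIdealScalingEqProofs
import HarnessLib

/-!
# The Heegner-module envelope with a GENERAL multiplier `a = Σᵢ cᵢ (1+T)^i ∈ Λ`:
# levelwise `(Σᵢ cᵢ·conj_{γ^i})(proj_k s) ∈ ℤ_p[G_k]·κ_k` ⟹ `a • ℋ_∞(F) ≤ Λκ_∞(C)` ⟹ `(a)·I(ℋ_F) ⊆ I(Λκ_C)`
# (proofs file; the non-unit companion of `HeegnerEnvelopeUnitTwistProofs`)

Topic `NumberTheory/EllipticCurves`. THEOREMS ONLY; sequel of `HeegnerEnvelopeUnitTwistProofs` (there the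
group-ring element is a UNIT twist and cancels) and `HeegnerCharIdealScalingEqProofs`. Here the element
`a = Σ_{i∈S} C(cᵢ)(1+T)^i` is KEPT as a multiplier — the shape needed if the geometric half of the stub
`stub_envelopeTied` (crux stmt-BirchSwinnertonDyer-26359) delivers the `κ`-line membership only after an
augmentation-ZERO factor (e.g. `ω_{δ+1} = (1+T)^{p^{δ+1}} − 1`, which kills the `E(K_{δ+1})`-rational terms of
the trace recurrences), or after a `p`-power times a unit. Written by the cell `bsd-print-x9` seat `bsd-line-x9-p2`.

WHAT. `smul_heegnerModule_le_stabilizedHeegnerModule_of_levelwise_groupRing` (levelwise ⟹ `a • ℋ ≤ Λκ`) and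
`span_mul_heegnerCharIdeal_le_stabilizedHeegnerCharIdeal_of_smul_le` (`a • ℋ_F ≤ Λκ_C`, `a ≠ 0`, `𝔖` f.g.
torsion-free of `finrank 1`, `𝔖/ℋ_F` torsion ⟹ `(a)·I(ℋ_F) ≤ I(Λκ_C)`).
HONEST FRAMING: bookkeeping only; BSD is not proved by any of this.

References: [CastellaGrossiLeeSkinner2022] Rem. 4.1.4, Cor. 3.4.2 (the `(γ − 1)`-localisation);
[PerrinRiou1987BSMF] §0 p. 402, §3.4; [Washington1997] §13.2.
-/

set_option autoImplicit false

noncomputable section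

open scoped Classical Pointwise

open WeierstrassCurve Literature.NumberTheory.EllipticCurves
  Literature.NumberTheory.EllipticCurves.CastellaGrossiLeeSkinner2022 PowerSeries

universe u

namespace Literature.NumberTheory.EllipticCurves

variable {N : ℕ} [NeZero N] {W : WeierstrassCurve ℚ} [W.IsGloballyMinimal] {K : Type u} [Field K]
  [NumberField K] {p : ℕ} [Fact p.Prime] {κ : ZpExtension K p} {γ : Field.absoluteGaloisGroup K}
  {jbar : AlgebraicClosure K →+* ℂ} (D : (W.baseChange K).LambdaAdicSelmerData κ γ)
  (F : HeegnerFamily N W K κ jbar) (C : StabilizedHeegnerData N W K κ jbar)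

/-- **Levelwise ⟹ Λ-adic with a general group-ring multiplier.** For `a = Σ_{i∈S} C(cᵢ)(1+T)^i ∈ Λ`: if for
every spanning family `s` of `ℋ_∞(F)` and every `k > δ` the level-`k` shadow `Σᵢ cᵢ·conj_{γ^i}(proj_k s)` lies
in `ℤ_p[Gal(K_k/K)]·κ_k(C)`, then `a • ℋ_∞(F) ≤ Λκ_∞(C)` (`proj_sum_C_mul_one_add_X_pow_smul`; span induction).
[cite: CastellaGrossiLeeSkinner2022, Rem. 4.1.4] [cite: PerrinRiou1987BSMF, §3.4] -/
theorem smul_heegnerModule_le_stabilizedHeegnerModule_of_levelwise_groupRing (S : Finset ℕ) (c : ℕ → ℤ_[p])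
    (hlev : ∀ (s : D.S), (∀ j, D.proj j s ∈ heegnerModuleLayer γ F j) → ∀ (k : ℕ) (hk : C.depth < k),
      (∑ i ∈ S, (W.baseChange K).padicPi p (κ.layerSubgroup k) (c i)
        ((W.baseChange K).conjPi p (κ.layerSubgroup k) (γ ^ i) (D.proj k s))) ∈
          stabilizedModuleLayer γ C k hk) :
    (∑ i ∈ S, (PowerSeries.C (c i) : IwasawaAlgebra p) * (1 + PowerSeries.X) ^ i) • heegnerModule D F ≤
      stabilizedHeegnerModule D C := by
  intro t ht
  obtain ⟨s, hs, rfl⟩ := (Submodule.mem_smul_pointwise_iff_exists _ _ _).mp ht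
  clear ht
  unfold heegnerModule at hs
  induction hs using Submodule.span_induction with
  | mem g hg =>
    refine mem_stabilizedHeegnerModule_of_proj_mem D C fun k hk ↦ ?_
    rw [proj_sum_C_mul_one_add_X_pow_smul]
    exact hlev g hg k hk
  | zero => rw [smul_zero]; exact Submodule.zero_mem _
  | add x y _ _ hx hy => rw [smul_add]; exact Submodule.add_mem _ hx hy
  | smul r x _ hx => rw [smul_comm]; exact Submodule.smul_mem _ r hx

/-- **`a • ℋ_F ⊆ Λκ_C ⟹ (a)·I(ℋ_F) ⊆ I(Λκ_C)`** for ANY `a ≠ 0` in `Λ`, `𝔖 = D.S` finitely generated,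
torsion-free, of `finrank 1`, `𝔖/ℋ_F` torsion (`char(𝔖/a•ℋ) = (a)·char(𝔖/ℋ)`, `Module.charIdeal_quotient_smul_eq_span_mul`).
[cite: CastellaGrossiLeeSkinner2022, Rem. 4.1.4 and §3.3] [cite: PerrinRiou1987BSMF, §1 p. 405] -/
theorem span_mul_heegnerCharIdeal_le_stabilizedHeegnerCharIdeal_of_smul_le
    [Module.Finite (IwasawaAlgebra p) D.S] [NoZeroSMulDivisors (IwasawaAlgebra p) D.S]
    (hS1 : Module.finrank (IwasawaAlgebra p) D.S = 1) {a : IwasawaAlgebra p} (ha : a ≠ 0)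
    (hle : a • heegnerModule D F ≤ stabilizedHeegnerModule D C)
    (htor : Module.IsTorsion (IwasawaAlgebra p) (D.S ⧸ heegnerModule D F)) :
    Ideal.span {a} * heegnerCharIdeal D F ≤ stabilizedHeegnerCharIdeal D C := by
  obtain ⟨s₀, hs₀⟩ := Module.exists_torsionFree_of_finrank_eq_one (p := p) hS1
  obtain ⟨⟨b, hb⟩, hbs⟩ := @htor (Submodule.Quotient.mk s₀)
  rw [Submonoid.mk_smul, ← Submodule.Quotient.mk_smul, Submodule.Quotient.mk_eq_zero] at hbs
  have hb0 : b ≠ 0 := nonZeroDivisors.ne_zero hb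
  have hs00 : s₀ ≠ 0 := fun h ↦ one_ne_zero (hs₀ 1 (by rw [h, smul_zero]))
  have hz0 : b • s₀ ≠ 0 := smul_ne_zero hb0 hs00
  have hz : ∀ c : IwasawaAlgebra p, c • (b • s₀) = 0 → c = 0 := fun c hc ↦
    (smul_eq_zero.mp hc).resolve_right hz0
  have htorL := Module.isTorsion_quotient_span_singleton_of_torsionFree_of_finrank_eq_one hS1 hz
  have hne : heegnerModule D F ≠ ⊥ := fun h ↦ hz0 (by rw [h] at hbs; exact (Submodule.mem_bot _).mp hbs)
  have htorA : Module.IsTorsion (IwasawaAlgebra p) (D.S ⧸ a • heegnerModule D F) :=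
    Module.isTorsion_quotient_of_smul_le hS1 hne ha le_rfl
  rw [heegnerCharIdeal, ← Module.charIdeal_quotient_smul_eq_span_mul ha htorA hbs hz0 htorL,
    stabilizedHeegnerCharIdeal]
  exact Module.charIdeal_quotient_le_of_le hle htorA

end Literature.NumberTheory.EllipticCurves

end
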